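import Summits.QuantumFields.YangMills.Theses.LangevinControlUV
import Summits.QuantumFields.YangMills.Theorems.HypercubicLimit.Negative.NonTrivialityBridge

/-!
# `OSLegsFromFemtoAndGap` — negative-side support II: renormalisations are witness data
# (the ∀-scheme strengthening of the conclusion is false)

Second support file for crux `stmt-QuantumFields-9367`
(`Summit.QuantumFields.YangMills.Theses.LangevinControlUV.OSLegsFromFemtoAndGap`), extracted from
the standing disprover's work file `Cruxes/OSLegsFromFemtoAndGap/Disproof.lean` §7; sibling of
`Negative/UnitsAndGapFree.lean` (p72925); uses the `HypercubicLimit` bridge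
`not_twoPointNontrivial_of_factorizes`. Tree objects only, nothing posited.

* `latticeSchwinger_eq_zero_of_c_string_zero`, `schwinger_eq_zero_of_c_string_zero`: along a
  scheme tied to `T` by `IsYangMillsFor`, the Schwinger functions of a species string that is
  unrenormalised at every step (`c ≡ 0` on the string) vanish on every real off-diagonal tensor.
* `not_isNontrivial_of_curv_unrenormalised`: hence with `c_{curv} ≡ 0` NO OS datum that is
  Yang–Mills along the scheme is non-trivial in the curvature field.
* `not_forall_scheme_strengthening`: for every `G`, `r`, every unit map `a > 0` with `a → 0` and
  every `S₁, β₂`, it is FALSE that every scheme in units `a` with `β_k → ∞` and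
  `L_k ≥ S₁(β_k)` carries non-trivial Yang–Mills OS data — the `∃ sch` of the crux's conclusion
  (renormalisations as witness data, Jaffe–Witten fn. 1) cannot be strengthened to `∀ sch`. [folklore]
-/

noncomputable section

open MeasureTheory Filter Topology
open Literature.MathematicalPhysics.AQFT Literature.MathematicalPhysics.QuantumLattice
open Literature.MathematicalPhysics.QuantumFieldTheory

namespace Summit.QuantumFields.YangMills.Theorems.OSLegsFromFemtoAndGap.Negative

section ForallScheme

variable {G : Type} [Group G] [TopologicalSpace G] [IsTopologicalGroup G] [CompactSpace G]
  [MeasurableSpace G] [BorelSpace G]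

/-- If every species of the string `σ` is unrenormalised at step `k` (`c_{σ i}(k) = 0`), the
lattice Schwinger function of positive degree vanishes at step `k`. [folklore] -/
theorem latticeSchwinger_eq_zero_of_c_string_zero {N : ℕ} (ρ : G →* Matrix (Fin N) (Fin N) ℂ)
    (sch : SpeciesScheme (YMSpecies G)) (k n : ℕ) (hn : n ≠ 0) (σ : Fin n → YMSpecies G)
    (hc : ∀ i, sch.c (σ i) k = 0) (f : Fin n → SchwartzMap (EuclideanSpace ℝ (Fin 4)) ℝ) :
    latticeSchwinger ρ sch (fun s => s.F) k n σ f = 0 := by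
  obtain ⟨j, rfl⟩ := Nat.exists_eq_succ_of_ne_zero hn
  simp [latticeSchwinger, smearedLatticeField, hc]

omit [TopologicalSpace G] [IsTopologicalGroup G] [CompactSpace G] [MeasurableSpace G] [BorelSpace G] in
/-- One-variable test functions are off-diagonal (empty coincidence locus). [folklore] -/
theorem isOffDiagonal_fin_one (F : SchwartzMap (Fin 1 → EuclideanSpace ℝ (Fin 4)) ℂ) :
    IsOffDiagonal F := by
  intro x hx
  obtain ⟨i, j, hij, -⟩ := hx
  exact absurd (Subsingleton.elim i j) hij

/-- Along a scheme tied to `T` by `IsYangMillsFor`, the Schwinger functions of a string that is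
unrenormalised at every step vanish on every real off-diagonal tensor. [folklore] -/
theorem schwinger_eq_zero_of_c_string_zero (r : LatticeRep G) (sch : SpeciesScheme (YMSpecies G))
    (T : OSData (YMSpecies G) 4) (hYM : IsYangMillsFor r sch T) {n : ℕ} (hn : n ≠ 0)
    (σ : Fin n → YMSpecies G) (hc : ∀ k i, sch.c (σ i) k = 0)
    (f : Fin n → SchwartzMap (EuclideanSpace ℝ (Fin 4)) ℝ)
    (F : SchwartzMap (Fin n → EuclideanSpace ℝ (Fin 4)) ℂ)
    (hF : IsTensorOf F (fun i => ofRealTest (f i))) (hoff : IsOffDiagonal F) :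
    T.schwinger n σ F = 0 := by
  have ht := hYM n hn σ f F hF hoff
  have hz : (fun k : ℕ => ((latticeSchwinger r.ρ sch (fun s => s.F) k n σ f : ℝ) : ℂ)) =
      fun _ => 0 := by
    funext k
    rw [latticeSchwinger_eq_zero_of_c_string_zero r.ρ sch k n hn σ (hc k) f]
    simp
  rw [hz] at ht
  exact tendsto_nhds_unique ht tendsto_const_nhds

/-- **The curvature renormalisation is load-bearing.** If `c_{curv}(k) = 0` for every `k`, NO OS
datum tied to the scheme by `IsYangMillsFor` is non-trivial in the curvature field: the complex
time-ordered clause reduces to real half-space tensors (`not_twoPointNontrivial_of_factorizes`),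
on which `IsYangMillsFor` pins `T` to the vanishing lattice limits. [folklore] -/
theorem not_isNontrivial_of_curv_unrenormalised (r : LatticeRep G)
    (sch : SpeciesScheme (YMSpecies G)) (hc : ∀ k, sch.c r.curvature k = 0)
    (T : OSData (YMSpecies G) 4) (hYM : IsYangMillsFor r sch T) :
    ¬ T.IsNontrivial r.curvature := by
  unfold OSData.IsNontrivial
  apply HypercubicLimit.Negative.not_twoPointNontrivial_of_factorizes
  intro u v hu hv
  have h2 := schwinger_eq_zero_of_c_string_zero r sch T hYM (by norm_num) (fun _ => r.curvature)
    (fun k _ => hc k) ![u, v] _ (HypercubicLimit.Negative.isTensorOf_tensor₂ u v)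
    (HypercubicLimit.Negative.isOffDiagonal_of_halfSpaces hu hv
      (HypercubicLimit.Negative.isTensorOf_tensor₂ u v))
  have h1 := schwinger_eq_zero_of_c_string_zero r sch T hYM one_ne_zero (fun _ => r.curvature)
    (fun k _ => hc k) ![u] _ (HypercubicLimit.Negative.isTensorOf_tensor₁ u)
    (isOffDiagonal_fin_one _)
  rw [h2, h1, zero_mul]

/-- **The ∀-scheme strengthening of the crux's conclusion is FALSE** (for every `G`, `r`, every
unit map with `a > 0`, `a → 0`, every `S₁, β₂`): not EVERY scheme in units `a` with `β_k → ∞`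
and `L_k ≥ S₁(β_k)` carries OS data that are Yang–Mills along it and non-trivial in the
curvature — the zero-renormalisation scheme `β_k = β₂ + k`, `L_k = max (S₁ β_k) ⌈k / a(β_k)⌉₊`
carries only curvature-trivial ones. The `∃ sch` of the conclusion is essential
(renormalisations are witness DATA). [cite: JaffeWitten2000, §4 fn. 1] -/
theorem not_forall_scheme_strengthening (r : LatticeRep G) {a : ℝ → ℝ} (ha : ∀ β, 0 < a β)
    (hlim : Tendsto a atTop (𝓝 0)) (S₁ : ℝ → ℕ) (β₂ : ℝ) :
    ¬ ∀ sch : SpeciesScheme (YMSpecies G), (∀ k, sch.a k = a (sch.β k)) →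
        Tendsto sch.β atTop atTop → (∀ k, S₁ (sch.β k) ≤ sch.L k) →
          ∃ T : OSData (YMSpecies G) 4, IsYangMillsFor r sch T ∧ T.IsNontrivial r.curvature := by
  intro h
  let sch : SpeciesScheme (YMSpecies G) :=
    { a := fun k => a (β₂ + k)
      a_pos := fun k => ha _
      tendsto_a := hlim.comp (tendsto_atTop_add_const_left _ _ tendsto_natCast_atTop_atTop)
      β := fun k => β₂ + k
      L := fun k => max (S₁ (β₂ + k)) ⌈(k : ℝ) / a (β₂ + k)⌉₊
      tendsto_L := by
        refine tendsto_atTop_mono (fun k => ?_) tendsto_natCast_atTop_atTop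
        have hak := ha (β₂ + k)
        calc (k : ℝ) = a (β₂ + k) * ((k : ℝ) / a (β₂ + k)) := by field_simp
          _ ≤ a (β₂ + k) * (⌈(k : ℝ) / a (β₂ + k)⌉₊ : ℝ) :=
              mul_le_mul_of_nonneg_left (Nat.le_ceil _) hak.le
          _ ≤ a (β₂ + k) * ((max (S₁ (β₂ + k)) ⌈(k : ℝ) / a (β₂ + k)⌉₊ : ℕ) : ℝ) :=
              mul_le_mul_of_nonneg_left (by exact_mod_cast le_max_right _ _) hak.le
      c := fun _ _ => 0
      m := fun _ _ => 0 }
  obtain ⟨T, hYM, hNT⟩ := h sch (fun _ => rfl)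
    (tendsto_atTop_add_const_left _ _ tendsto_natCast_atTop_atTop) (fun _ => le_max_left _ _)
  exact not_isNontrivial_of_curv_unrenormalised r sch (fun _ => rfl) T hYM hNT

end ForallScheme

end Summit.QuantumFields.YangMills.Theorems.OSLegsFromFemtoAndGap.Negative

end
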